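import Mathlib
import Literature.AlgebraicGeometry.Resolution.EtaleLocalAlgebra
import HarnessLib

/-!
# Splitting base: a finite étale local extension with prescribed separable residue field

W4.4 (crux `NoZenoR`, stmt-ResolutionOfSingularities-19943), brick **BC-0** of the (L1)-PREP v1
base-change package (route (F1) for `stub_L1wCore`): for a local ring `(A, 𝔪, κ)` and a finite
separable extension `κ₁/κ` there is a monic `f ∈ A[X]` (a lift of the minimal polynomial of a
primitive element of `κ₁/κ`) such that `B := A[X]/(f)` is

* local, with `𝔪·B = 𝔪_B` and `A → B` a local homomorphism,
* finite free over `A` (hence flat), and étale (indeed standard étale: `f'` is a unit in `B`),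
* with residue field `κ_B ≃ₐ[κ] κ₁`.

This is the "(R-fin) splitting base" of the prep note: every ingredient of the local-étale
hypothesis bundle of Lipman (16.1)/(16.5) is discharged by `B`, and `κ_B` can be taken to contain
any finite separable extension of `κ` prescribed in advance. Folklore (EGA 0_III 10.3.1 for the
existence of flat local extensions with given residue field; here the finite separable case, where
the extension is finite étale). Everything is PROVED; no named facts.

OURS (cell res-hironaka, chain W4.4); AI-written, weaker than expert review; nothing here is a
statement of the manuscript under review.
-/

noncomputable section

set_option linter.dupNamespace false

open IsLocalRing Polynomial

namespace Summit.ResolutionOfSingularities.ResolutionOfSingularities.Theorems.NoZeno.SplittingBase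

universe u v

variable {A : Type u} [CommRing A] [IsLocalRing A]

/-- If `B` is an integral `A`-algebra over a local ring `A` and `𝔪_A·B` is a maximal ideal of `B`,
then `B` is local (its unique maximal ideal being `𝔪_A·B`). [folklore] -/
theorem isLocalRing_of_isMaximal_map {B : Type v} [CommRing B] [Algebra A B]
    [Algebra.IsIntegral A B]
    (hmax : ((maximalIdeal A).map (algebraMap A B)).IsMaximal) : IsLocalRing B := by
  refine IsLocalRing.of_unique_max_ideal ⟨_, hmax, fun N hN => ?_⟩
  haveI := hN
  have hc : N.comap (algebraMap A B) = maximalIdeal A :=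
    IsLocalRing.eq_maximalIdeal (Ideal.isMaximal_comap_of_isIntegral_of_isMaximal N)
  have hle : (maximalIdeal A).map (algebraMap A B) ≤ N := by
    rw [← hc]; exact Ideal.map_comap_le
  exact (hmax.eq_of_le hN.ne_top hle).symm

/-- In the situation of `isLocalRing_of_isMaximal_map`, the maximal ideal of `B` is `𝔪_A·B`.
[folklore] -/
theorem maximalIdeal_eq_map_of_isMaximal_map {B : Type v} [CommRing B] [Algebra A B]
    [IsLocalRing B] (hmax : ((maximalIdeal A).map (algebraMap A B)).IsMaximal) :
    (maximalIdeal A).map (algebraMap A B) = maximalIdeal B :=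
  IsLocalRing.eq_maximalIdeal hmax

/-- A ring homomorphism of local rings mapping `𝔪_A` into `𝔪_B` is local. [folklore] -/
theorem isLocalHom_of_map_le {B : Type v} [CommRing B] [Algebra A B] [IsLocalRing B]
    (h : (maximalIdeal A).map (algebraMap A B) ≤ maximalIdeal B) :
    IsLocalHom (algebraMap A B) :=
  ((local_hom_TFAE (algebraMap A B)).out 0 2).mpr h

omit [IsLocalRing A] in
/-- If `f' ` is a unit in `A[X]/(f)` for a monic `f`, then `A[X]/(f)` is standard étale over `A`
(the standard étale pair `(f, 1)`), in particular étale. [folklore] -/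
theorem isStandardEtale_adjoinRoot_of_isUnit_derivative {f : A[X]} (hf : f.Monic)
    (hu : IsUnit (AdjoinRoot.mk f (derivative f))) :
    Algebra.IsStandardEtale A (AdjoinRoot f) := by
  -- `f' p₁ + f p₂ = 1` from the unit
  obtain ⟨y, hy⟩ := hu.exists_right_inv
  obtain ⟨p₁, rfl⟩ := AdjoinRoot.mk_surjective y
  have hdvd : f ∣ derivative f * p₁ - 1 := by
    rw [← AdjoinRoot.mk_eq_zero, map_sub, map_mul, hy, map_one, sub_self]
  obtain ⟨c, hc⟩ := hdvd
  let P : StandardEtalePair A :=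
    { f := f, monic_f := hf, g := 1,
      cond := ⟨p₁, -c, 1, by rw [one_pow, mul_neg, ← hc]; ring⟩ }
  -- the two maps
  have hX : P.HasMap (AdjoinRoot.root f) := by
    refine ⟨?_, ?_⟩
    · show aeval (AdjoinRoot.root f) f = 0
      rw [AdjoinRoot.aeval_eq, AdjoinRoot.mk_self]
    · show IsUnit (aeval (AdjoinRoot.root f) (1 : A[X]))
      rw [map_one]; exact isUnit_one
  let φ : P.Ring →ₐ[A] AdjoinRoot f := P.lift (AdjoinRoot.root f) hX
  let ψ : AdjoinRoot f →ₐ[A] P.Ring :=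
    AdjoinRoot.liftAlgHom f (Algebra.ofId A P.Ring) P.X (by
      have := P.hasMap_X.1
      rwa [aeval_def] at this)
  have h₁ : φ.comp ψ = AlgHom.id A (AdjoinRoot f) := by
    apply AdjoinRoot.algHom_ext
    simp [φ, ψ, AdjoinRoot.liftAlgHom_root, StandardEtalePair.lift_X]
  have h₂ : ψ.comp φ = AlgHom.id A P.Ring := by
    apply StandardEtalePair.hom_ext
    simp [φ, ψ, AdjoinRoot.liftAlgHom_root, StandardEtalePair.lift_X]
  let e : P.Ring ≃ₐ[A] AdjoinRoot f := AlgEquiv.ofAlgHom φ ψ h₁ h₂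
  exact Algebra.IsStandardEtale.of_equiv e

/-- **BC-0 (splitting base).** For a local ring `A` with residue field `κ` and a finite separable
extension `κ₁/κ`, there is a monic `f ∈ A[X]` of degree `[κ₁ : κ]` such that `B := A[X]/(f)`
(`AdjoinRoot f`) is local, finite free and étale over `A`, `A → B` is a local homomorphism with
`𝔪_A·B = 𝔪_B`, and the residue field of `B` is `κ`-isomorphic to `κ₁`. [folklore; EGA 0_III
(10.3.1)–(10.3.2) in the finite separable case] -/
theorem exists_adjoinRoot_isLocalRing_etale_residueField_algEquiv (A : Type u) [CommRing A]
    [IsLocalRing A] (κ₁ : Type v) [Field κ₁] [Algebra (ResidueField A) κ₁]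
    [FiniteDimensional (ResidueField A) κ₁] [Algebra.IsSeparable (ResidueField A) κ₁] :
    ∃ f : A[X], f.Monic ∧ f.natDegree = Module.finrank (ResidueField A) κ₁ ∧ 0 < f.natDegree ∧
      ∃ (_ : IsLocalRing (AdjoinRoot f)) (_ : IsLocalHom (algebraMap A (AdjoinRoot f))),
        Module.Free A (AdjoinRoot f) ∧ Module.Finite A (AdjoinRoot f) ∧
        Algebra.IsStandardEtale A (AdjoinRoot f) ∧ Algebra.Etale A (AdjoinRoot f) ∧
        (maximalIdeal A).map (algebraMap A (AdjoinRoot f)) = maximalIdeal (AdjoinRoot f) ∧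
        Nonempty (ResidueField (AdjoinRoot f) ≃ₐ[ResidueField A] κ₁) := by
  classical
  set κ := ResidueField A with hκ
  -- primitive element and its minimal polynomial
  obtain ⟨α, hα⟩ := Field.exists_primitive_element κ κ₁
  have hint : IsIntegral κ α := IsIntegral.of_finite κ α
  set g : κ[X] := minpoly κ α with hg
  have hg_monic : g.Monic := minpoly.monic hint
  have hg_sep : g.Separable := Algebra.IsSeparable.isSeparable κ α
  have hg_irr : Irreducible g := minpoly.irreducible hint
  have hg_deg : g.natDegree = Module.finrank κ κ₁ := by
    rw [hg, ← IntermediateField.adjoin.finrank hint, hα, IntermediateField.finrank_top']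
  have hg_pos : 0 < g.natDegree := minpoly.natDegree_pos hint
  -- lift to a monic `f ∈ A[X]`
  obtain ⟨f, hf_map, hf_deg, hf_monic⟩ :=
    Polynomial.lifts_and_natDegree_eq_and_monic
      (Polynomial.mem_lifts_of_surjective (f := residue A) residue_surjective g) hg_monic
  refine ⟨f, hf_monic, by rw [hf_deg, hg_deg], by rw [hf_deg]; exact hg_pos, ?_⟩
  -- `B := AdjoinRoot f` is finite free
  haveI hfree : Module.Free A (AdjoinRoot f) := hf_monic.free_adjoinRoot
  haveI hfin : Module.Finite A (AdjoinRoot f) := hf_monic.finite_adjoinRoot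
  -- the ideal `𝔪_A·B` (written `Ideal.map (AdjoinRoot.of f) (maximalIdeal A)`) and the quotient
  -- `B/𝔪_A B ≃ₐ[A] κ[X]/(g)`
  have hmap_f : Polynomial.map (Ideal.Quotient.mk (maximalIdeal A)) f = g := hf_map
  -- `AdjoinRoot g` is a field
  haveI : Fact (Irreducible g) := ⟨hg_irr⟩
  have hspan : (Ideal.span {Polynomial.map (residue A) f} : Ideal κ[X]) = Ideal.span {g} := by
    rw [hf_map]
  let E₁ : (AdjoinRoot f ⧸ Ideal.map (AdjoinRoot.of f) (maximalIdeal A)) ≃ₐ[A] AdjoinRoot g :=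
    (AdjoinRoot.quotEquivQuotMap f (maximalIdeal A)).trans (Ideal.quotientEquivAlgOfEq A hspan)
  have hmax : (Ideal.map (AdjoinRoot.of f) (maximalIdeal A)).IsMaximal :=
    Ideal.Quotient.maximal_of_isField _
      (MulEquiv.isField (Field.toIsField (AdjoinRoot g)) E₁.toMulEquiv)
  have halg : algebraMap A (AdjoinRoot f) = AdjoinRoot.of f := AdjoinRoot.algebraMap_eq f
  have hmax' : ((maximalIdeal A).map (algebraMap A (AdjoinRoot f))).IsMaximal := by
    rw [halg]; exact hmax
  haveI hloc : IsLocalRing (AdjoinRoot f) := isLocalRing_of_isMaximal_map hmax'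
  have hmB' : (maximalIdeal A).map (algebraMap A (AdjoinRoot f)) = maximalIdeal (AdjoinRoot f) :=
    maximalIdeal_eq_map_of_isMaximal_map hmax'
  have hmB : Ideal.map (AdjoinRoot.of f) (maximalIdeal A) = maximalIdeal (AdjoinRoot f) := by
    rw [← halg]; exact hmB'
  haveI hlh : IsLocalHom (algebraMap A (AdjoinRoot f)) := isLocalHom_of_map_le hmB'.le
  -- `f'` is a unit in `B`: its image in the field `B/𝔪B ≃ AdjoinRoot g` is `g'(root g) ≠ 0`
  have hunit : IsUnit (AdjoinRoot.mk f (derivative f)) := by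
    by_contra hnu
    have hmem : AdjoinRoot.mk f (derivative f) ∈ maximalIdeal (AdjoinRoot f) := hnu
    rw [← hmB] at hmem
    have h0 : Ideal.Quotient.mk (Ideal.map (AdjoinRoot.of f) (maximalIdeal A))
        (AdjoinRoot.mk f (derivative f)) = 0 :=
      Ideal.Quotient.eq_zero_iff_mem.mpr hmem
    have hd : Polynomial.map (Ideal.Quotient.mk (maximalIdeal A)) (derivative f) = derivative g := by
      rw [← Polynomial.derivative_map, hmap_f]; rfl
    have h1 : E₁ (Ideal.Quotient.mk (Ideal.map (AdjoinRoot.of f) (maximalIdeal A))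
        (AdjoinRoot.mk f (derivative f))) = AdjoinRoot.mk g (derivative g) := by
      simp only [E₁, AlgEquiv.trans_apply, AdjoinRoot.quotEquivQuotMap_apply_mk]
      rw [hd]
      rfl
    have h2 : AdjoinRoot.mk g (derivative g) ≠ 0 := by
      rw [← AdjoinRoot.aeval_eq]
      exact hg_sep.aeval_derivative_ne_zero (by rw [AdjoinRoot.aeval_eq, AdjoinRoot.mk_self])
    exact h2 (by rw [← h1, h0, map_zero])
  haveI hse : Algebra.IsStandardEtale A (AdjoinRoot f) :=
    isStandardEtale_adjoinRoot_of_isUnit_derivative hf_monic hunit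
  haveI het : Algebra.Etale A (AdjoinRoot f) := inferInstance
  -- residue field: `κ_B = B/𝔪_B ≃ B/𝔪_A B ≃ κ[X]/(g) ≃ κ(α) = κ₁`, first over `A`, then over `κ`
  letI : Algebra A κ₁ := ((algebraMap κ κ₁).comp (algebraMap A κ)).toAlgebra
  haveI : IsScalarTower A κ κ₁ := IsScalarTower.of_algebraMap_eq (fun _ => rfl)
  let E₂ : AdjoinRoot g ≃ₐ[κ] κ₁ :=
    (IntermediateField.adjoinRootEquivAdjoin κ hint).trans
      ((IntermediateField.equivOfEq hα).trans IntermediateField.topEquiv)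
  let E₀ : ResidueField (AdjoinRoot f) ≃ₐ[A]
      (AdjoinRoot f ⧸ Ideal.map (AdjoinRoot.of f) (maximalIdeal A)) :=
    Ideal.quotientEquivAlgOfEq A hmB.symm
  let E : ResidueField (AdjoinRoot f) ≃ₐ[A] κ₁ := (E₀.trans E₁).trans (E₂.restrictScalars A)
  have hsurj : Function.Surjective (algebraMap A κ) := residue_surjective
  exact ⟨hloc, hlh, hfree, hfin, hse, het, hmB', ⟨AlgEquiv.extendScalarsOfSurjective hsurj E⟩⟩

/-- **BC-0, hypothesis-bundle form.** Over a Noetherian local ring `A`, the splitting base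
`B = A[X]/(f)` of `exists_adjoinRoot_isLocalRing_etale_residueField_algEquiv` satisfies the whole
local-étale hypothesis bundle of the base-change package (the binders of
`Literature.AlgebraicGeometry.Resolution.Lipman1969_16_1_ii` / `Lipman1969_16_5`): `B` Noetherian
local, `A → B` local, flat (indeed finite free) and étale, `𝔪_A·B = 𝔪_B`, `κ_B/κ_A` separable (indeed
`κ`-isomorphic to the prescribed `κ₁`); moreover `dim B = dim A` and `B` is regular iff `A` is
(`EtaleLocalAlgebra`). [folklore] -/
theorem exists_adjoinRoot_localEtale_bundle (A : Type u) [CommRing A] [IsLocalRing A]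
    [IsNoetherianRing A] (κ₁ : Type v) [Field κ₁] [Algebra (ResidueField A) κ₁]
    [FiniteDimensional (ResidueField A) κ₁] [Algebra.IsSeparable (ResidueField A) κ₁] :
    ∃ f : A[X], f.Monic ∧ f.natDegree = Module.finrank (ResidueField A) κ₁ ∧
      ∃ (_ : IsLocalRing (AdjoinRoot f)) (_ : IsLocalHom (algebraMap A (AdjoinRoot f))),
        IsNoetherianRing (AdjoinRoot f) ∧ Module.Flat A (AdjoinRoot f) ∧
        Module.Finite A (AdjoinRoot f) ∧ Algebra.Etale A (AdjoinRoot f) ∧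
        (maximalIdeal A).map (algebraMap A (AdjoinRoot f)) = maximalIdeal (AdjoinRoot f) ∧
        Algebra.IsSeparable (ResidueField A) (ResidueField (AdjoinRoot f)) ∧
        Nonempty (ResidueField (AdjoinRoot f) ≃ₐ[ResidueField A] κ₁) ∧
        ringKrullDim (AdjoinRoot f) = ringKrullDim A ∧
        (IsRegularLocalRing (AdjoinRoot f) ↔ IsRegularLocalRing A) := by
  obtain ⟨f, hf, hdeg, -, hloc, hlh, hfree, hfin, -, het, hmB, ⟨e⟩⟩ :=
    exists_adjoinRoot_isLocalRing_etale_residueField_algEquiv A κ₁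
  haveI := hloc; haveI := hlh; haveI := hfree; haveI := hfin; haveI := het
  haveI hN : IsNoetherianRing (AdjoinRoot f) := IsNoetherianRing.of_finite A (AdjoinRoot f)
  refine ⟨f, hf, hdeg, hloc, hlh, hN, inferInstance, hfin, het, hmB, ?_, ⟨e⟩,
    Literature.AlgebraicGeometry.Resolution.ringKrullDim_eq_of_etaleLocal A (AdjoinRoot f),
    Literature.AlgebraicGeometry.Resolution.isRegularLocalRing_iff_of_etaleLocal A (AdjoinRoot f)⟩
  exact Algebra.IsSeparable.of_algHom (ResidueField A) κ₁ e.toAlgHom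

/-! ## BC-4′: lengths are invariant under base change to the splitting base

Mathlib's `IsLocalRing.length_baseChange` (`ℓ_B(B ⊗_A M) = ℓ_A(M) · ℓ_B(B/𝔪_A B)`) specialised to
`𝔪_A·B = 𝔪_B`: then `B/𝔪_A B = κ_B` has length one and `ℓ_B(B ⊗_A M) = ℓ_A(M)`. This is the
`h⁰`-invariance used by the minimality-ascent step (BC-4) of the base-change package. -/

section LengthBaseChange

open TensorProduct

/-- **BC-4′.** For a flat local homomorphism `A → B` of local rings with `𝔪_A·B = 𝔪_B` and any
`A`-module `M`: `ℓ_B(B ⊗_A M) = ℓ_A(M)`. In particular this holds for the splitting base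
`B = A[X]/(f)` of `exists_adjoinRoot_localEtale_bundle`. [folklore; Mathlib
`IsLocalRing.length_baseChange`] -/
theorem length_baseChange_eq_of_map_maximalIdeal_eq {B : Type v} [CommRing B] [IsLocalRing B]
    [Algebra A B] [IsLocalHom (algebraMap A B)] [Module.Flat A B]
    (h : (maximalIdeal A).map (algebraMap A B) = maximalIdeal B)
    (M : Type*) [AddCommGroup M] [Module A M] :
    Module.length B (B ⊗[A] M) = Module.length A M := by
  have h1 : Module.length B (B ⧸ (maximalIdeal A).map (algebraMap A B)) = 1 := by
    rw [h, Module.length_eq_one_iff]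
    exact isSimpleModule_iff_quot_maximal.mpr
      ⟨maximalIdeal B, IsLocalRing.maximalIdeal.isMaximal B, ⟨LinearEquiv.refl _ _⟩⟩
  rw [IsLocalRing.length_baseChange, h1, mul_one]

end LengthBaseChange

/-! ## BC-0′: the pointwise splitting neighbourhood (separable, not necessarily irreducible,
reduction)

When the monic `f ∈ A[X]` is only required to have SEPARABLE reduction `f̄` (e.g. the base change
`f ⊗ 1` of a splitting polynomial to a larger local ring `A' ⊇ A`, where `f̄` may factor), `B := A[X]/(f)`
is still finite free and (standard) étale over `A`, but no longer local: its maximal ideals are the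
simple factors of `f̄`. Every local ring `B_𝔫` at a maximal ideal is then an étale-local `A`-algebra
satisfying the same hypothesis bundle (flat, unramified, essentially of finite type, local
homomorphism, `𝔪_A·B_𝔫 = 𝔪_{B_𝔫}`, finite separable residue extension, `dim B_𝔫 = dim A`,
regular iff `A` is). This is the shape in which the base-change package meets the NEW germ
`D' → D'_B = (D' ⊗_D B)_{z'}` (route (F1), STEP 2/5 of the (L1)-prep note). -/

section Pointwise

/-- Over a local ring, `𝔪_A·B` lies in the Jacobson radical of any integral `A`-algebra `B`.
[folklore] -/
theorem map_maximalIdeal_le_jacobson_bot {B : Type v} [CommRing B] [Algebra A B]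
    [Algebra.IsIntegral A B] :
    (maximalIdeal A).map (algebraMap A B) ≤ (⊥ : Ideal B).jacobson := by
  rw [Ideal.jacobson, le_sInf_iff]
  rintro N ⟨-, hN⟩
  haveI := hN
  have hc : N.comap (algebraMap A B) = maximalIdeal A :=
    IsLocalRing.eq_maximalIdeal (Ideal.isMaximal_comap_of_isIntegral_of_isMaximal N)
  rw [← hc]
  exact Ideal.map_comap_le

/-- An element of an integral algebra `B` over a local ring `A` which is a unit modulo `𝔪_A·B` is
a unit. [folklore] -/
theorem isUnit_of_isUnit_quotient_map_maximalIdeal {B : Type v} [CommRing B] [Algebra A B]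
    [Algebra.IsIntegral A B] {x : B}
    (hx : IsUnit (Ideal.Quotient.mk ((maximalIdeal A).map (algebraMap A B)) x)) : IsUnit x := by
  obtain ⟨y, hy⟩ := hx.exists_right_inv
  obtain ⟨y, rfl⟩ := Ideal.Quotient.mk_surjective y
  rw [← map_mul, ← map_one (Ideal.Quotient.mk _), Ideal.Quotient.eq] at hy
  have hu : IsUnit (x * y) :=
    Ideal.isUnit_of_sub_one_mem_jacobson_bot _ (map_maximalIdeal_le_jacobson_bot hy)
  exact isUnit_of_mul_isUnit_left hu

/-- **Separable reduction ⇒ `f'` is a unit in `A[X]/(f)`** (for `f` monic over a local ring `A`):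
`f̄` separable means `a·f̄ + b·f̄' = 1` in `κ[X]`, so `f'` is a unit modulo `𝔪_A·B`, hence a
unit. [folklore] -/
theorem isUnit_mk_derivative_of_separable_map {f : A[X]} (hf : f.Monic)
    (hsep : (Polynomial.map (residue A) f).Separable) :
    IsUnit (AdjoinRoot.mk f (derivative f)) := by
  haveI := hf.finite_adjoinRoot
  have halg : algebraMap A (AdjoinRoot f) = AdjoinRoot.of f := AdjoinRoot.algebraMap_eq f
  have hsep' : (Polynomial.map (Ideal.Quotient.mk (maximalIdeal A)) f).Separable := hsep
  -- in `κ[X]/(f̄)` the class of `f̄'` is a unit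
  obtain ⟨a, b, hab⟩ := hsep'
  have hu : IsUnit (Ideal.Quotient.mk
      (Ideal.span {Polynomial.map (Ideal.Quotient.mk (maximalIdeal A)) f})
      (derivative (Polynomial.map (Ideal.Quotient.mk (maximalIdeal A)) f))) := by
    have hmul : Ideal.Quotient.mk
        (Ideal.span {Polynomial.map (Ideal.Quotient.mk (maximalIdeal A)) f})
        (derivative (Polynomial.map (Ideal.Quotient.mk (maximalIdeal A)) f)) *
        Ideal.Quotient.mk _ b = 1 := by
      rw [← map_mul, ← map_one (Ideal.Quotient.mk _), Ideal.Quotient.eq, Ideal.mem_span_singleton]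
      exact ⟨-a, by linear_combination hab⟩
    have hmul' : Ideal.Quotient.mk _ b * Ideal.Quotient.mk
        (Ideal.span {Polynomial.map (Ideal.Quotient.mk (maximalIdeal A)) f})
        (derivative (Polynomial.map (Ideal.Quotient.mk (maximalIdeal A)) f)) = 1 := by
      rw [← map_mul, ← map_one (Ideal.Quotient.mk _), Ideal.Quotient.eq, Ideal.mem_span_singleton]
      exact ⟨-a, by linear_combination hab⟩
    exact ⟨⟨_, _, hmul, hmul'⟩, rfl⟩
  -- transport along `B/𝔪B ≃ κ[X]/(f̄)`
  have key : IsUnit (Ideal.Quotient.mk (Ideal.map (AdjoinRoot.of f) (maximalIdeal A))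
      (AdjoinRoot.mk f (derivative f))) := by
    have h1 : AdjoinRoot.quotEquivQuotMap f (maximalIdeal A)
        (Ideal.Quotient.mk (Ideal.map (AdjoinRoot.of f) (maximalIdeal A))
          (AdjoinRoot.mk f (derivative f))) =
        Ideal.Quotient.mk _ (derivative (Polynomial.map (Ideal.Quotient.mk (maximalIdeal A)) f)) := by
      rw [AdjoinRoot.quotEquivQuotMap_apply_mk, Polynomial.derivative_map]
    rw [← h1] at hu
    exact (isUnit_map_iff (AdjoinRoot.quotEquivQuotMap f (maximalIdeal A)) _).mp hu
  rw [← halg] at key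
  exact isUnit_of_isUnit_quotient_map_maximalIdeal key

/-- **Separable reduction ⇒ standard étale**: `A[X]/(f)` is standard étale (in particular étale,
flat, unramified) over the local ring `A` whenever `f` is monic with separable reduction.
[folklore] -/
theorem isStandardEtale_adjoinRoot_of_separable_map {f : A[X]} (hf : f.Monic)
    (hsep : (Polynomial.map (residue A) f).Separable) :
    Algebra.IsStandardEtale A (AdjoinRoot f) :=
  isStandardEtale_adjoinRoot_of_isUnit_derivative hf (isUnit_mk_derivative_of_separable_map hf hsep)

/-- **BC-0′ (pointwise splitting neighbourhood).** Let `A` be a Noetherian local ring and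
`f ∈ A[X]` monic with separable reduction, `B := A[X]/(f)` and `𝔫` a maximal ideal of `B`. Then
the local ring `B_𝔫` is an étale-local `A`-algebra: Noetherian, `A → B_𝔫` a local homomorphism,
flat, formally unramified and essentially of finite type, `𝔪_A·B_𝔫 = 𝔪_{B_𝔫}`, the residue field
of `B_𝔫` finite separable over `κ_A`, `dim B_𝔫 = dim A`, and `B_𝔫` regular iff `A` is — i.e. the
hypothesis bundle of `Lipman1969_16_1_ii` / `Lipman1969_16_5` holds for `A → B_𝔫`. [folklore] -/
theorem localization_adjoinRoot_localEtale_bundle [IsNoetherianRing A] {f : A[X]} (hf : f.Monic)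
    (hsep : (Polynomial.map (residue A) f).Separable)
    (𝔫 : Ideal (AdjoinRoot f)) [𝔫.IsMaximal] :
    IsNoetherianRing (Localization.AtPrime 𝔫) ∧
      ∃ (_ : IsLocalHom (algebraMap A (Localization.AtPrime 𝔫))),
      Module.Flat A (Localization.AtPrime 𝔫) ∧
      Algebra.FormallyUnramified A (Localization.AtPrime 𝔫) ∧
      Algebra.EssFiniteType A (Localization.AtPrime 𝔫) ∧
      (maximalIdeal A).map (algebraMap A (Localization.AtPrime 𝔫)) =
        maximalIdeal (Localization.AtPrime 𝔫) ∧
      Algebra.IsSeparable (ResidueField A) (ResidueField (Localization.AtPrime 𝔫)) ∧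
      Module.Finite (ResidueField A) (ResidueField (Localization.AtPrime 𝔫)) ∧
      ringKrullDim (Localization.AtPrime 𝔫) = ringKrullDim A ∧
      (IsRegularLocalRing (Localization.AtPrime 𝔫) ↔ IsRegularLocalRing A) := by
  haveI hfree : Module.Free A (AdjoinRoot f) := hf.free_adjoinRoot
  haveI hfin : Module.Finite A (AdjoinRoot f) := hf.finite_adjoinRoot
  haveI hse : Algebra.IsStandardEtale A (AdjoinRoot f) :=
    isStandardEtale_adjoinRoot_of_separable_map hf hsep
  haveI : Algebra.Etale A (AdjoinRoot f) := inferInstance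
  haveI hN : IsNoetherianRing (AdjoinRoot f) := IsNoetherianRing.of_finite A (AdjoinRoot f)
  -- the local ring `B_𝔫`
  haveI hNl : IsNoetherianRing (Localization.AtPrime 𝔫) := inferInstance
  haveI hfl : Module.Flat A (Localization.AtPrime 𝔫) := inferInstance
  haveI hur : Algebra.FormallyUnramified A (Localization.AtPrime 𝔫) := inferInstance
  haveI heft : Algebra.EssFiniteType A (Localization.AtPrime 𝔫) := by
    haveI : Algebra.EssFiniteType (AdjoinRoot f) (Localization.AtPrime 𝔫) :=
      Algebra.EssFiniteType.of_isLocalization _ 𝔫.primeCompl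
    exact Algebra.EssFiniteType.comp A (AdjoinRoot f) (Localization.AtPrime 𝔫)
  -- `A → B_𝔫` is local: `𝔪_A B_𝔫 ≤ 𝔫 B_𝔫 = 𝔪_{B_𝔫}`
  have hle : (maximalIdeal A).map (algebraMap A (Localization.AtPrime 𝔫)) ≤
      maximalIdeal (Localization.AtPrime 𝔫) := by
    rw [IsScalarTower.algebraMap_eq A (AdjoinRoot f) (Localization.AtPrime 𝔫), ← Ideal.map_map,
      ← Localization.AtPrime.map_eq_maximalIdeal]
    apply Ideal.map_mono
    have hc : 𝔫.comap (algebraMap A (AdjoinRoot f)) = maximalIdeal A :=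
      IsLocalRing.eq_maximalIdeal (Ideal.isMaximal_comap_of_isIntegral_of_isMaximal 𝔫)
    rw [← hc]
    exact Ideal.map_comap_le
  haveI hlh : IsLocalHom (algebraMap A (Localization.AtPrime 𝔫)) := isLocalHom_of_map_le hle
  refine ⟨hNl, hlh, hfl, hur, heft, Algebra.FormallyUnramified.map_maximalIdeal, inferInstance,
    inferInstance,
    Literature.AlgebraicGeometry.Resolution.ringKrullDim_eq_of_etaleLocal A (Localization.AtPrime 𝔫),
    Literature.AlgebraicGeometry.Resolution.isRegularLocalRing_iff_of_etaleLocal A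
      (Localization.AtPrime 𝔫)⟩

end Pointwise

end Summit.ResolutionOfSingularities.ResolutionOfSingularities.Theorems.NoZeno.SplittingBase

end
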